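/-
Copyright (c) 2026 the pub-hodgecm-mathlib formalisation cell (harness21).  Prover seat hodgecm-mathlib-K2E4-p11 (g9): Track B «K2-LIT»,
hLiu418 = stmt-HodgeConjecture-24832, socket #41 KIND W, organ «Φ6b-ind» (J1) (LEAD F0P6-plan (g14) BATCH #178 (1), KW desk F0P2-p08 (g3)):
HOLOMORPHY IN `s` OF THE POLYNOMIAL MOMENTS `∫ P(x)·ξ-integrand(1, h; a + s, b + s)(x) dx` of Shimura's ξ on `Herm₂(ℂ)`, for EVERY hermitian `h`.
THEOREMS ONLY (no `def`, no `instance`, no `notation`, no named-fact hypothesis, no `sorry`).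
-/
import Summits.HodgeConjecture.HodgeConjecture.Theorems.K2LiuXiTwoMomentsAsHDerivatives        -- ★ `norm_moment_le`, `aestronglyMeasurable_moment`, `eval_traceForm`
import Summits.HodgeConjecture.HodgeConjecture.Theorems.K2LiuHermTwoConfluentXiHolomorphy        -- ★ `hasDerivAt_xiTwoIntegrand_affine`
import Literature.Analysis.Complex.HolomorphicParametricIntegral                                  -- ★ `differentiableOn_integral_of_dominated`
import HarnessLib

/-!
# Crux `HLiu418`, ROAD Φ ∕ KIND W organ «Φ6b-ind», (J1): the polynomial moments of the ξ-integrand are HOLOMORPHIC in the parameter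

Cell `hodgecm-mathlib`, crux item hLiu418 = `stmt-HodgeConjecture-24832` (helper lane `--supports … --as helper`, count-neutral), route of record
`HCCMUnconditional`; squad K2 ∕ K2Liu, road `K2_Liu`, socket #41, KIND W.  First of the three files paying the jet-continuation letter `hJet` of the
«Φ6b-ind» consumer head `K2LiuKindWArchIndefiniteLetter` at orders `e ≥ 1`.

WHAT.  For a hermitian `h` (ANY signature), a polynomial weight `P` in the entries of `x ∈ Herm₂(ℂ)` and a base point `(a, b)`:
* `differentiableOn_moment` — `s ↦ ∫ P(x)·ξ-integrand(1, h; a + s, b + s)(x) dx` is holomorphic on the half-plane of absolute convergence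
  `{s | 3 + deg P < re(a + b + 2s)}` (dominated holomorphic parametric integrals, ★ `Literature.Analysis.Complex.differentiableOn_integral_of_dominated`:
  the integrand is entire in `s` (★ `hasDerivAt_xiTwoIntegrand_affine`) and locally uniformly dominated by `C·|det(1 + ix)|^{−(σ − deg P)}`, `σ > 3 + deg P`
  (★ `norm_moment_le`, ★ `integrable_norm_det_add_I_smul_rpow_neg`));
* `differentiableOn_traceMoment` — the case `P = (−2πi·tr(Θx))^e` (the `e`-th `h`-line jet of ξ, ★ `iteratedDeriv_xiTwo_hLine`): holomorphic on
  `{s | 3 + e < re(a + b + 2s)}`.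
[Shimura1982, §3 (3.1)–(3.3)] [Shimura1997, §16.4].
HONEST LABEL.  Count-neutral helper of the K2_Liu road; it pays no socket by itself: `HC_CM` is proved only modulo the 7 printed citations
(2 remaining named inputs: hLiu418 = `stmt-HodgeConjecture-24832`, h413 = `stmt-HodgeConjecture-24833`) until rung 0 closes.

## References
* [Shimura1982] G. Shimura, *Confluent hypergeometric functions on tube domains*, Math. Ann. 260 (1982) 269–302: §3.
* [Shimura1997] G. Shimura, *Euler Products and Eisenstein Series*, CBMS 93 (1997): §16.4.
-/

set_option autoImplicit false
-- the mandated namespace repeats the single-problem summit's segment (`HodgeConjecture.HodgeConjecture`)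
set_option linter.dupNamespace false

noncomputable section

open scoped Matrix ComplexConjugate ComplexOrder
open Complex Matrix MeasureTheory Metric Set

namespace Summit.HodgeConjecture.HodgeConjecture.Cruxes.HLiu418.K2LiuHermTwoXiMomentHolomorphy

open Summit.HodgeConjecture.HodgeConjecture.Cruxes.HLiu418.K2LiuHermTwoGammaDefs
open Summit.HodgeConjecture.HodgeConjecture.Cruxes.HLiu418.K2LiuHermTwoConfluentXiDefs
open Summit.HodgeConjecture.HodgeConjecture.Cruxes.HLiu418.K2LiuHermTwoDetPowerIntegrable
open Summit.HodgeConjecture.HodgeConjecture.Cruxes.HLiu418.K2LiuHermTwoConfluentXiConvergence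
open Summit.HodgeConjecture.HodgeConjecture.Cruxes.HLiu418.K2LiuHermTwoConfluentXiHolomorphy
open Summit.HodgeConjecture.HodgeConjecture.Cruxes.HLiu418.K2LiuXiTwoMomentsAsHDerivatives

/-- **THE ξ-INTEGRAND IS ENTIRE IN THE DIAGONAL PARAMETER**: `s ↦ ξ-integrand(1, h; a + s, b + s)(x)` is complex-differentiable everywhere. [folklore] -/
theorem differentiable_xiTwoIntegrand_diag (h : Matrix (Fin 2) (Fin 2) ℂ) (a b : ℂ) (c : ℝ × ℂ × ℝ) :
    Differentiable ℂ (fun s : ℂ => xiTwoIntegrand 1 h (a + s) (b + s) c) := by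
  have e : (fun s : ℂ => xiTwoIntegrand 1 h (a + s) (b + s) c) = fun s : ℂ => xiTwoIntegrand 1 h (a + 1 * s) (b + 1 * s) c := by
    simp only [one_mul]
  rw [e]
  exact fun s => (hasDerivAt_xiTwoIntegrand_affine Matrix.PosDef.one a b 1 1 c s).differentiableAt

/-- **THE POLYNOMIAL MOMENTS OF THE ξ-INTEGRAND ARE HOLOMORPHIC IN `s`** (organ «Φ6b-ind» (J1)): for a hermitian `h` of ANY signature, a polynomial
weight `P` in the entries of `x` and `a b : ℂ`, `s ↦ ∫ P(x)·ξ-integrand(1, h; a + s, b + s)(x) dx` is holomorphic on `{s | 3 + deg P < re(a + b + 2s)}`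
(dominated holomorphic parametric integral: local majorant `C·|det(1 + ix)|^{−(σ − deg P)}` with `σ > 3 + deg P`). [cite: Shimura1982, §3] [cite: Shimura1997, §16.4] -/
theorem differentiableOn_moment (P : MvPolynomial (Fin 2 × Fin 2) ℂ) {h : Matrix (Fin 2) (Fin 2) ℂ} (hh : h.IsHermitian) (a b : ℂ) :
    DifferentiableOn ℂ (fun s : ℂ => ∫ c : ℝ × ℂ × ℝ,
      MvPolynomial.eval (fun jk : Fin 2 × Fin 2 => hermTwo c jk.1 jk.2) P * xiTwoIntegrand 1 h (a + s) (b + s) c)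
      {s : ℂ | 3 + (P.totalDegree : ℝ) < (a + b + 2 * s).re} := by
  set d : ℝ := (P.totalDegree : ℝ) with hd
  refine Literature.Analysis.Complex.differentiableOn_integral_of_dominated (μ := (volume : Measure (ℝ × ℂ × ℝ)))
    (F := fun s c => MvPolynomial.eval (fun jk : Fin 2 × Fin 2 => hermTwo c jk.1 jk.2) P * xiTwoIntegrand 1 h (a + s) (b + s) c)
    (fun s _ => aestronglyMeasurable_moment P 1 h (a + s) (b + s))
    (Filter.Eventually.of_forall fun c => ((differentiable_const _).mul (differentiable_xiTwoIntegrand_diag h a b c)).differentiableOn)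
    fun s₀ hs₀ => ?_
  -- the local domination around `s₀`
  set t₀ : ℝ := (a + b + 2 * s₀).re with ht₀
  have ht₀' : 3 + d < t₀ := hs₀
  set R : ℝ := (t₀ - 3 - d) / 4 with hR
  have hRpos : 0 < R := by rw [hR]; linarith
  set t₁ : ℝ := t₀ - 2 * R with ht₁
  have ht₁3 : 3 < t₁ - d := by rw [ht₁, hR]; linarith
  set M : ℝ := ‖a‖ + ‖b‖ + 2 * (‖s₀‖ + R) with hM
  set C₀ : ℝ := (∑ e ∈ P.support, ‖P.coeff e‖) * Real.exp (2 * Real.pi * M) with hC₀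
  have hC₀nn : 0 ≤ C₀ := by positivity
  -- points of the ball: exponent at least `t₁`, imaginary parts at most `M`
  have hball : ∀ s ∈ ball s₀ R, t₁ ≤ (a + s + (b + s)).re ∧ |(a + s).im| + |(b + s).im| ≤ M := by
    intro s hs
    have hsd : ‖s - s₀‖ < R := by rw [← dist_eq_norm]; exact hs
    have hs' : ‖s‖ ≤ ‖s₀‖ + R := by have := norm_sub_norm_le s s₀; linarith
    refine ⟨?_, ?_⟩
    · have hre : (a + s + (b + s)).re = t₀ + 2 * (s - s₀).re := by
        rw [ht₀]; simp only [add_re, sub_re, mul_re, re_ofNat, im_ofNat]; ring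
      rw [hre, ht₁]
      have := Complex.abs_re_le_norm (s - s₀)
      linarith [neg_abs_le (s - s₀).re]
    · have h1 : |(a + s).im| ≤ ‖a‖ + ‖s‖ := (Complex.abs_im_le_norm _).trans (norm_add_le _ _)
      have h2 : |(b + s).im| ≤ ‖b‖ + ‖s‖ := (Complex.abs_im_le_norm _).trans (norm_add_le _ _)
      rw [hM]
      linarith
  refine ⟨R, hRpos, fun s hs => ?_, fun c => C₀ * ‖(1 + I • hermTwo c).det‖ ^ (-(t₁ - d)), ?_, ?_⟩
  · -- the ball lies in the half-plane
    show 3 + d < (a + b + 2 * s).re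
    have h1 := (hball s hs).1
    have e : (a + s + (b + s)).re = (a + b + 2 * s).re := by congr 1; ring
    linarith [e ▸ h1]
  · -- the majorant is integrable
    exact (integrable_norm_det_add_I_smul_rpow_neg Matrix.PosDef.one ht₁3).const_mul C₀
  · -- the domination
    refine Filter.Eventually.of_forall fun c s hs => ?_
    obtain ⟨hre, him⟩ := hball s hs
    have hD : 1 ≤ ‖(1 + I • hermTwo c).det‖ := one_le_norm_det c
    refine (norm_moment_le P hh (a + s) (b + s) c).trans ?_
    have hexp : Real.exp (2 * Real.pi * (|(a + s).im| + |(b + s).im|)) ≤ Real.exp (2 * Real.pi * M) :=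
      Real.exp_le_exp.mpr (mul_le_mul_of_nonneg_left him (by positivity))
    have hpow : ‖(1 + I • hermTwo c).det‖ ^ (-((a + s + (b + s)).re - (P.totalDegree : ℝ))) ≤ ‖(1 + I • hermTwo c).det‖ ^ (-(t₁ - d)) :=
      Real.rpow_le_rpow_of_exponent_le hD (by rw [hd] at *; linarith)
    calc (∑ e ∈ P.support, ‖P.coeff e‖) * Real.exp (2 * Real.pi * (|(a + s).im| + |(b + s).im|)) *
          ‖(1 + I • hermTwo c).det‖ ^ (-((a + s + (b + s)).re - (P.totalDegree : ℝ)))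
        ≤ (∑ e ∈ P.support, ‖P.coeff e‖) * Real.exp (2 * Real.pi * M) * ‖(1 + I • hermTwo c).det‖ ^ (-(t₁ - d)) :=
          mul_le_mul (mul_le_mul_of_nonneg_left hexp (Finset.sum_nonneg fun _ _ => norm_nonneg _)) hpow
            (Real.rpow_nonneg (norm_nonneg _) _) (by positivity)
      _ = C₀ * ‖(1 + I • hermTwo c).det‖ ^ (-(t₁ - d)) := by rw [hC₀]

/-- **THE `e`-TH `h`-LINE JET OF ξ IS HOLOMORPHIC IN `s`**: for hermitian `h` (any signature), any `Θ`, `e : ℕ` and `a b : ℂ`, the trace moment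
`s ↦ ∫ (−2πi·tr(Θx))^e·ξ-integrand(1, h; a + s, b + s)(x) dx` (`= (d∕dt)^e ξ(1, h + tΘ; a + s, b + s)|₀` for hermitian `Θ`, ★ `iteratedDeriv_xiTwo_hLine`)
is holomorphic on `{s | 3 + e < re(a + b + 2s)}`. [cite: Shimura1982, §3] [cite: Shimura1997, §16.4] -/
theorem differentiableOn_traceMoment {h : Matrix (Fin 2) (Fin 2) ℂ} (hh : h.IsHermitian) (Θ : Matrix (Fin 2) (Fin 2) ℂ) (e : ℕ) (a b : ℂ) :
    DifferentiableOn ℂ (fun s : ℂ => ∫ c : ℝ × ℂ × ℝ,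
      (-(2 * Real.pi * I) * (Θ * hermTwo c).trace) ^ e * xiTwoIntegrand 1 h (a + s) (b + s) c) {s : ℂ | 3 + (e : ℝ) < (a + b + 2 * s).re} := by
  set L : MvPolynomial (Fin 2 × Fin 2) ℂ :=
    MvPolynomial.C (-(2 * Real.pi * I)) * ∑ jk : Fin 2 × Fin 2, MvPolynomial.C (Θ jk.2 jk.1) * MvPolynomial.X jk with hL
  have hLeval : ∀ c : ℝ × ℂ × ℝ, MvPolynomial.eval (fun jk : Fin 2 × Fin 2 => hermTwo c jk.1 jk.2) (L ^ e) = (-(2 * Real.pi * I) * (Θ * hermTwo c).trace) ^ e :=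
    fun c => by rw [map_pow, hL, eval_traceForm Θ c]
  have hdeg : ((L ^ e).totalDegree : ℝ) ≤ e := by
    have h1 : (L ^ e).totalDegree ≤ e * 1 :=
      (MvPolynomial.totalDegree_pow _ _).trans (Nat.mul_le_mul_left _ (by rw [hL]; exact totalDegree_traceForm_le Θ))
    rw [mul_one] at h1
    exact_mod_cast h1
  have hfun : (fun s : ℂ => ∫ c : ℝ × ℂ × ℝ, (-(2 * Real.pi * I) * (Θ * hermTwo c).trace) ^ e * xiTwoIntegrand 1 h (a + s) (b + s) c) =
      fun s : ℂ => ∫ c : ℝ × ℂ × ℝ, MvPolynomial.eval (fun jk : Fin 2 × Fin 2 => hermTwo c jk.1 jk.2) (L ^ e) * xiTwoIntegrand 1 h (a + s) (b + s) c := by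
    funext s
    simp only [hLeval]
  rw [hfun]
  exact (differentiableOn_moment (L ^ e) hh a b).mono fun s (hs : 3 + (e : ℝ) < (a + b + 2 * s).re) => by
    show 3 + ((L ^ e).totalDegree : ℝ) < (a + b + 2 * s).re
    linarith

end Summit.HodgeConjecture.HodgeConjecture.Cruxes.HLiu418.K2LiuHermTwoXiMomentHolomorphy

end
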